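import Summits.CriticalPhenomena.PercolationContinuityZ3.Theorems.PercNearOneGluingNoHeavyLowerTailSahiCombMixAtoms
import Summits.CriticalPhenomena.PercolationContinuityZ3.Theorems.PercNearOneGluingNoHeavyLowerTailSahiCombMixFourSingleFour
import Summits.CriticalPhenomena.PercolationContinuityZ3.Theorems.PercNearOneGluingNoHeavyLowerTailSahiCombMixCoinTransfer

/-!
# The comb hierarchy for Sahi's `E_k`, LXIII: Venn atoms of FIVE events ignoring `e` are comb-positive off `e`; degree bookkeeping for multidegree `4`
# (the building blocks for lifting q = 1 certificates of the three single-member order-4 cells, `…SahiCombMixFiveSingleCells`)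

Support file of the one-cut programme (crux `NoHeavyLowerTail`, stmt-CriticalPhenomena-4575; cell `prim-masterthm`, seat P3, gen 10; HIERARCHY §18(l)).  The `n = 5` analogue
of `…SahiCombMixAtoms` (gen 8, four events): the Venn atom `Π_t lit b_t 1_{U_t}` of five events (`SahiMixture.atom5`, `lit b x = x` or `1 − x`) has nonnegative mass
(`ex_atom5_nonneg`), ignores `e` when the events do (`atom5_insert`) and its `μ_p`-mass is comb-positive at multidegree `1` off `e` (`combPos_atom5_off`); its mass is the
inclusion–exclusion combination of the member moments (expanded in the certificate files by `simp [atom5, lit]` + `ring`).  Degree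
identities `deg13/deg31` (`deg22` is gen 8's) and products `combPos_mono4/13/22/112` for assembling degree-4 certificate terms (atom × order-3 row, atom² × covariance, …).  These are exactly
the comb-positive building blocks of ttrl's her5/1 certificates (`c_j = Σ coeff·(Π atoms)·E_T + Σ coeff·Π atoms` in moment coordinates; conventions checked against this
seat's cells by `py/her5/check_cert.py`).  HONEST FRAMING: bookkeeping; nothing here asserts (M⁺-k) or `C_k` for `k ≥ 3`. [this work]
-/

noncomputable section

open scoped Classical

namespace Summit.CriticalPhenomena.PercolationContinuityZ3.Theorems

open Finset Function
open Literature.Combinatorics.Sahi2008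
open Literature.Probability.Percolation.DecisionTree (ind ind_of_mem ind_of_not_mem ind_nonneg)
open SahiComb

namespace SahiMixture

variable {α : Type*} [Fintype α]

/-- The indicator of the Venn cell of five events with occurrence pattern `(b₀,…,b₄)`: `Π_t (1_{A_t} if b_t else 1 − 1_{A_t})`. [folklore] -/
def atom5 (A : Fin 5 → Set α) (b0 b1 b2 b3 b4 : Bool) : α → ℝ :=
  fun a => lit b0 (ind (A 0) a) * lit b1 (ind (A 1) a) * lit b2 (ind (A 2) a) * lit b3 (ind (A 3) a) * lit b4 (ind (A 4) a)

omit [Fintype α] in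
/-- Atoms are pointwise nonnegative. [folklore] -/
theorem atom5_nonneg (A : Fin 5 → Set α) (b0 b1 b2 b3 b4 : Bool) (a : α) : 0 ≤ atom5 A b0 b1 b2 b3 b4 a :=
  mul_nonneg (mul_nonneg (mul_nonneg (mul_nonneg (lit_ind_nonneg _ _ a) (lit_ind_nonneg _ _ a)) (lit_ind_nonneg _ _ a)) (lit_ind_nonneg _ _ a))
    (lit_ind_nonneg _ _ a)

/-- Atoms of five events have nonnegative mass. [folklore] -/
theorem ex_atom5_nonneg {μ : α → ℝ} (hμ : ∀ a, 0 ≤ μ a) (A : Fin 5 → Set α) (b0 b1 b2 b3 b4 : Bool) :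
    0 ≤ ex μ (atom5 A b0 b1 b2 b3 b4) :=
  ex_nonneg hμ fun a => atom5_nonneg A b0 b1 b2 b3 b4 a

end SahiMixture

variable {ι : Type} [Fintype ι]

namespace SahiCombMix

/-! ### Degree bookkeeping off `e` at multidegree `4` -/

omit [Fintype ι] in
/-- `(1 off e) + (3 off e) = (4 off e)`. [folklore] -/
theorem deg13 (e : ι) : update (fun _ : ι => (1 : ℕ)) e 0 + update (fun _ : ι => (3 : ℕ)) e 0 = update (fun _ : ι => 4) e 0 := by
  funext x; by_cases hx : x = e
  · subst hx; simp
  · simp [hx]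

omit [Fintype ι] in
/-- `(3 off e) + (1 off e) = (4 off e)`. [folklore] -/
theorem deg31 (e : ι) : update (fun _ : ι => (3 : ℕ)) e 0 + update (fun _ : ι => (1 : ℕ)) e 0 = update (fun _ : ι => 4) e 0 := by
  funext x; by_cases hx : x = e
  · subst hx; simp
  · simp [hx]

/-- Product of four functions comb-positive at multidegree `1` off `e`. [this work] -/
theorem combPos_mono4 (e : ι) {f g k l : (ι → unitInterval) → ℝ} (hf : CombPos (update (fun _ : ι => 1) e 0) f)
    (hg : CombPos (update (fun _ : ι => 1) e 0) g) (hk : CombPos (update (fun _ : ι => 1) e 0) k) (hl : CombPos (update (fun _ : ι => 1) e 0) l) :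
    CombPos (update (fun _ : ι => 4) e 0) (fun p => f p * g p * k p * l p) :=
  (combPos_mono3 e hf hg hk).mul_of_eq hl (deg31 e)

/-- A function comb-positive at multidegree `1` off `e` times one at multidegree `3` off `e`. [this work] -/
theorem combPos_mono13 (e : ι) {f g : (ι → unitInterval) → ℝ} (hf : CombPos (update (fun _ : ι => 1) e 0) f)
    (hg : CombPos (update (fun _ : ι => 3) e 0) g) : CombPos (update (fun _ : ι => 4) e 0) (fun p => f p * g p) :=
  hf.mul_of_eq hg (deg13 e)

/-- Product of two functions comb-positive at multidegree `2` off `e`. [this work] -/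
theorem combPos_mono22 (e : ι) {f g : (ι → unitInterval) → ℝ} (hf : CombPos (update (fun _ : ι => 2) e 0) f)
    (hg : CombPos (update (fun _ : ι => 2) e 0) g) : CombPos (update (fun _ : ι => 4) e 0) (fun p => f p * g p) :=
  hf.mul_of_eq hg (deg22 e)

/-- Two functions at multidegree `1` off `e` times one at multidegree `2` off `e`. [this work] -/
theorem combPos_mono112 (e : ι) {f g k : (ι → unitInterval) → ℝ} (hf : CombPos (update (fun _ : ι => 1) e 0) f)
    (hg : CombPos (update (fun _ : ι => 1) e 0) g) (hk : CombPos (update (fun _ : ι => 2) e 0) k) :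
    CombPos (update (fun _ : ι => 4) e 0) (fun p => f p * g p * k p) :=
  (combPos_mono2 e hf hg).mul_of_eq hk (deg22 e)

/-! ### Atoms of five events ignore `e` and are comb-positive off `e` -/

section Atoms

variable (U : Fin 5 → Set (Set ι)) (e : ι) (hUe : ∀ (j : Fin 5) (b : Bool), secAt e b (U j) = U j)
include hUe

omit [Fintype ι] in
/-- The Venn atoms of the `U_j` ignore `e`. [this work] -/
theorem atom5_insert (b0 b1 b2 b3 b4 : Bool) (ω : Set ι) :
    SahiMixture.atom5 U b0 b1 b2 b3 b4 (insert e ω) = SahiMixture.atom5 U b0 b1 b2 b3 b4 ω := by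
  unfold SahiMixture.atom5
  rw [ind_U5_insert U e hUe, ind_U5_insert U e hUe, ind_U5_insert U e hUe, ind_U5_insert U e hUe, ind_U5_insert U e hUe]

/-- **Atom masses of five events are comb-positive at multidegree `1` off `e`.** [this work] -/
theorem combPos_atom5_off (b0 b1 b2 b3 b4 : Bool) :
    CombPos (update (fun _ : ι => 1) e 0) (fun p => ex (bernoulliWeight p) (SahiMixture.atom5 U b0 b1 b2 b3 b4)) :=
  (combPos_ex (ι := ι) (h := SahiMixture.atom5 U b0 b1 b2 b3 b4) fun ω => SahiMixture.atom5_nonneg U b0 b1 b2 b3 b4 ω).of_ignores e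
    fun p s => SahiCombDisjunct.ex_update_of_ignores' e (fun ω => atom5_insert U e hUe b0 b1 b2 b3 b4 ω) p s

end Atoms

end SahiCombMix

end Summit.CriticalPhenomena.PercolationContinuityZ3.Theorems

end
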